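import Summits.BirchSwinnertonDyer.Rank1Residual.O5.O5CompanionTransport
import Summits.BirchSwinnertonDyer.Rank1Residual.Additive.CompanionTypeIffLocIrrThreeHolds
import Literature.NumberTheory.EllipticCurves.HondaStrongIsomorphismMultiplicativeProofs
import Literature.NumberTheory.EllipticCurves.AdditiveReductionSemistableModelProofs
import Literature.NumberTheory.EllipticCurves.LFunctionPrimeCoeff
import Literature.NumberTheory.EllipticCurves.OrdinaryPrimesProofs
import Literature.NumberTheory.DiophantineGeometry.ConductorAdditiveProofs
import Literature.NumberTheory.DiophantineGeometry.ConductorFactorizationProofs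
import Literature.NumberTheory.DiophantineGeometry.ConductorRingOfIntegersProofs
import Mathlib.NumberTheory.Padics.HeightOneSpectrum
import HarnessLib

/-!
# O5 G3-2 `CompanionTypeLawThree`: the LOCAL HALF is a theorem (at a prime `3` of SEMISTABLE
# reduction, `3 ∣ a₃(G)` iff `G[3]|G_{ℚ₃}` is irreducible), and the node follows from ONE labelled
# binder — the Brauer–Nesbitt–Chebotarev transport `IsCompanionAtThree W G ⟹ G[3] ≅ W[3]`
# (cell `b2b-bsdres`, lane CLASS-CLOSURE / class O5; cross-cell pool work of seat `b2b-bsdres-x11b3-p4`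
# GEN 14 under the x11b3 lead's P-POOL rule R12-38 (b); first refusals o5-r1 / o5-r2 / cc-typer-5;
# THEOREMS ONLY)

HONEST FRAMING (cell `b2b-bsdres`, run/shared/lean/b2b/bsd-rank1-residual/, verbatim in every
file): the goal of the cell is to DELETE the COMBINATION-SHAPED residual classes of the
Birch–Swinnerton-Dyer formula for ALL analytic-rank `≤ 1` elliptic curves over `ℚ` — "full BSD
formula for every rank `≤ 1` curve in class `C`" assembled STRICTLY from published theorems — so
that the rank-`≤ 1` remainder becomes exactly the CONSTRUCTION-SHAPED classes, which are TYPED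
(missing-input `Prop`s), NOT attempted. This is not "finishing BSD". This file: THEOREMS ONLY (no
definition, no named fact, no `sorry`, no `@[conjecture]` node); nothing about any particular curve
is asserted; nothing is booked; no mark of `RESIDUAL-MAP.md` moves; O5 stays OPEN. The node
`CompanionTypeLawThree` is NOT closed here: it is derived from ONE labelled hypothesis `hBNC`
(cite-only, NOT a Literature fact, NOT discharged).

## What is proved

o5-r1 GEN 3's / cc-typer-5's typed THEOREM-CANDIDATE G3-2
`Summit.BirchSwinnertonDyer.Rank1Residual.O5.CompanionTypeLawThree` (`O5/O5CompanionTransport.lean`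
§2: for `W ∈ O5b` with `ρ̄_{W,3}` irreducible and an elliptic companion `G` semistable at `3`,
`3 ∣ a₃(G) ↔ LocIrr W 3`) splits into a GLOBAL step and a LOCAL step:

* GLOBAL (NOT proved here; the binder `hBNC`): `IsCompanionAtThree W G` (trace congruence
  `a_ℓ(W) ≡ a_ℓ(G) (mod 3)` at all `ℓ ∤ 3·N_W·N_G`) with `ρ̄_{W,3}` irreducible gives a
  `Gal(ℚ̄/ℚ)`-equivariant `G[3] ≅ W[3]` — "`ρ̄_G^{ss} ≅ ρ̄_W^{ss}` by Brauer–Nesbitt–Chebotarev; with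
  `ρ̄_W` irreducible, `ρ̄_G ≅ ρ̄_W`" in the node's own docstring; Darmon–Diamond–Taylor 1995,
  Prop. 2.6(b) with Prop. 2.8(a) and Prop. 2.11(a) — the same printed input that stands behind the
  tree's named fact `Literature.NumberTheory.EllipticCurves.not_irreducible_of_frobeniusTrace_congr`
  (`Literature/…/ModPReducibility.lean`); Mathlib has neither Chebotarev nor Brauer–Nesbitt for
  Galois representations, whence a HYPOTHESIS here (whether it becomes a typed node or a Literature
  fact is the typer's decision, not this file's);
* LOCAL (PROVED here, unconditionally, for EVERY globally minimal elliptic `G / ℚ`):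
  **`dvd_lFunction_three_iff_locIrr_three_of_not_nine_dvd_conductorNorm`** —
  `¬ 9 ∣ N_G → ((3 : ℤ) ∣ G.LFunction 3 ↔ LocIrr G 3)`, in the node's vocabulary (Mathlib's
  `WeierstrassCurve.LFunction`, whose `3`-rd coefficient is `a₃(G)` at good `3` and `±1` at
  multiplicative `3`).

Assembled: **`companionTypeLawThree_of_modThreeTransport (hBNC) : CompanionTypeLawThree`** =
LOCAL ∘ (`LocIrr` is a function of the `Γ_ℚ`-module `E[3]`, `Additive.locIrr_iff_of_equivariant`,
x11b3-p4 GEN 10, `Additive/CompanionTypeIffLocIrrThreeHolds.lean`) ∘ `hBNC`; the PER-PAIR form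
**`dvd_lFunction_three_iff_locIrr_three_of_equivariant`** (`W, G`, an equivariant `e : G[3] ≃ W[3]`
from any source, `9 ∤ N_G` ⟹ `3 ∣ a₃(G) ↔ LocIrr W 3`) is unconditional. Tools of independent
use: `not_locIrr_three_of_not_three_dvd_c₄` (`3 ∤ c₄` of the minimal model ⟹ `G[3]|G_{ℚ₃}`
reducible — the multiplicative and the good-ordinary rows at once) and
`nine_dvd_conductorNorm_of_three_dvd_of_three_dvd` (`3 ∣ Δ_min`, `3 ∣ c₄` ⟹ `9 ∣ N`).

WHAT IS NOT CLAIMED: `CompanionTypeLawThree` itself — it stays OPEN MODULO `hBNC`; G3-2's status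
(THEOREM-CANDIDATE tag, any restamp) is the O5 typer's pen — no restamp is asked of cc-typer-5 by
x11b3 (x11b3-lead R13-7 (2)); `hBNC` is a HYPOTHESIS, not a node minted here; `FlatMemberLawThree`,
`CompanionLambdaTransportLawThree`, `CompanionLambdaTransportExactThree`, `ModThreeLayerTransportThree`
(EVIDENCE conjecture nodes of the same file) are untouched; the link-table census of the node's
docstring (LocIrr → good-ss 33 204 links, generic → good-ord 27 998 + mult 19 765, 0 exceptions after
cleaning) stays EVIDENCE; the node's doc-only TARGET ↦ THEOREM restamp, if any, is the typer's pen
(cc-typer-5); nothing booked; O5 OPEN; no mark.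

## Proof of the local half

Let `I = integralModelInt G` (the global minimal model over `ℤ`, `Δ(I) = Δ_min`).
* `3 ∤ Δ_min`: GOOD reduction at `3` (`hasGoodReductionAtPrime_of_not_dvd`), `G.LFunction 3 = a₃(G)`
  (`LFunction_apply_prime_eq_frobeniusTrace`), and `LocIrr G 3 ↔ 3 ∣ a₃(G)` is
  `Additive.locIrr_three_iff_dvd_frobeniusTrace_of_hasGoodReductionAtPrime` (Serre 1972 §1.11 Prop.
  11–12, kernel theorem of x11b3-p4 GEN 10).
* `3 ∣ Δ_min`, `3 ∤ c₄(I)`: MULTIPLICATIVE reduction, `G.LFunction 3 = ±1` (tree theorem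
  `lFunction_prime_eq_one_or_eq_neg_one_of_dvd_of_not_dvd`, Silverman §C.16), so `3 ∤ a₃`; and
  `¬ LocIrr G 3` by L-O56-sel (`Additive.locIrr_three_iff_locIrrCriterionThree`:
  `LocIrr ↔ c₄ ≠ 0 ∧ (c₆ = 0 ∨ 3·v₃(c₄) + 2 ≤ 2·v₃(c₆))`): from `c₄³ − c₆² = 1728Δ` and `3 ∣ 1728`,
  `3 ∤ c₄ ⟹ 3 ∤ c₆`, so `v₃(c₄) = v₃(c₆) = 0`, `c₆ ≠ 0`, and the criterion fails.
* `3 ∣ Δ_min`, `3 ∣ c₄(I)`: ADDITIVE reduction at the place over `3`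
  (`hasAdditiveReductionAt_of_dvd_of_dvd`, Silverman VII.5.1(c)), so `f₃ ≥ 2`
  (`two_le_conductorExponent_iff_holds`, ATAEC IV.10.2(c)) and `9 ∣ N_G`
  (`factorization_conductorNorm_holds`) — excluded by the semistability binder `¬ 9 ∣ N_G`.

References: J.-P. Serre, *Propriétés galoisiennes des points d'ordre fini des courbes elliptiques*,
Invent. Math. 15 (1972), §1.11 Prop. 11–12 [Serre1972]; H. Darmon, F. Diamond, R. Taylor, *Fermat's
Last Theorem*, Current Developments in Mathematics 1995, Prop. 2.6(b), 2.8(a), 2.11(a)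
[DarmonDiamondTaylor1995]; J. H. Silverman, *The Arithmetic of Elliptic Curves*, 2nd ed. (2009),
VII.5.1, §C.16 [SilvermanAEC2009]; J. H. Silverman, *Advanced Topics*, GTM 151 (1994), IV.10.2
[SilvermanATAEC1994]; cell: `cells/o5o6/TARGETS.md` §O5 (o5-r1 GEN 3, G3-2), INBOX INTENT
2026-08-21T22:29Z (x11b3-p4 GEN 14), x11b3-lead R12-38 (b) / R13-7 (2) (approved as pool).

## Design

No definitions; `noncomputable section`; `open scoped Classical`. The `p² ∣ N ⟺ additive` bridge is
a private copy of the twelve-line argument of `Summits/ABC/ABC/Theorems/DefiniteXiFreyModularityStubNineTransfer.lean`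
(`sq_dvd_conductorNorm_iff_hasAdditiveReductionAt`), kept private to avoid an ABC import in an O5 file.
Axioms: `propext`, `Classical.choice`, `Quot.sound`.
-/

set_option autoImplicit false

noncomputable section

open scoped Classical

open WeierstrassCurve IsDedekindDomain NumberField Literature.NumberTheory.EllipticCurves
  Summit.BirchSwinnertonDyer.Rank1Residual.Additive

namespace Summit.BirchSwinnertonDyer.Rank1Residual.O5

/-! ## §1 The integer lemma: `3 ∤ c₄ ⟹ 3 ∤ c₆` -/

/-- For any Weierstrass equation `I` over `ℤ`: `3 ∤ c₄(I) ⟹ 3 ∤ c₆(I)` (from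
`c₄³ − c₆² = 1728·Δ` and `3 ∣ 1728`). [folklore] -/
theorem not_three_dvd_c₆_of_not_three_dvd_c₄ (I : WeierstrassCurve ℤ) (h4 : ¬ (3 : ℤ) ∣ I.c₄) :
    ¬ (3 : ℤ) ∣ I.c₆ := by
  intro h6
  apply h4
  have hrel : 1728 * I.Δ = I.c₄ ^ 3 - I.c₆ ^ 2 := I.c_relation
  have hcube : (3 : ℤ) ∣ I.c₄ ^ 3 := by
    have heq : I.c₄ ^ 3 = 1728 * I.Δ + I.c₆ ^ 2 := by linarith [hrel]
    rw [heq]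
    exact (Dvd.dvd.mul_right (by norm_num) _).add (dvd_pow h6 two_ne_zero)
  exact Int.prime_three.dvd_of_dvd_pow hcube

/-! ## §2 `3 ∤ c₄` of the minimal model ⟹ `G[3]|G_{ℚ₃}` reducible -/

section MinimalModel

variable (G : WeierstrassCurve ℚ) [G.IsElliptic] [G.IsGloballyMinimal]

/-- **`3 ∤ c₄(integralModelInt G) ⟹ ¬ LocIrr G 3`** (covers every multiplicative and every good
ordinary row at once): by L-O56-sel `LocIrr G 3 ↔ c₄ ≠ 0 ∧ (c₆ = 0 ∨ 3·v₃(c₄) + 2 ≤ 2·v₃(c₆))`, read on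
the integral model (`Additive.locIrrCriterionThree_iff_integralModelInt`); `3 ∤ c₄ ⟹ 3 ∤ c₆` (§1), so
`v₃(c₄) = v₃(c₆) = 0`, `c₆ ≠ 0` and the criterion fails. [cite: Serre1972, §1.11 Prop. 11] -/
theorem not_locIrr_three_of_not_three_dvd_c₄ (h4 : ¬ (3 : ℤ) ∣ (integralModelInt G).c₄) :
    ¬ LocIrr G 3 := by
  intro hL
  have h6 : ¬ (3 : ℤ) ∣ (integralModelInt G).c₆ :=
    not_three_dvd_c₆_of_not_three_dvd_c₄ (integralModelInt G) h4
  have h3 : ((3 : ℕ) : ℤ) = 3 := rfl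
  have hv4 : padicValInt 3 (integralModelInt G).c₄ = 0 :=
    padicValInt.eq_zero_of_not_dvd (by rwa [h3])
  have hv6 : padicValInt 3 (integralModelInt G).c₆ = 0 :=
    padicValInt.eq_zero_of_not_dvd (by rwa [h3])
  have h6ne : (integralModelInt G).c₆ ≠ 0 := fun h0 ↦ h6 (h0 ▸ dvd_zero 3)
  obtain ⟨_, hcrit⟩ := (locIrrCriterionThree_iff_integralModelInt G).mp
    ((locIrr_three_iff_locIrrCriterionThree G).mp hL)
  rcases hcrit with h0 | hle
  · exact h6ne h0
  · rw [hv4, hv6] at hle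
    omega

/-! ## §3 `3 ∣ Δ_min`, `3 ∣ c₄` ⟹ `9 ∣ N` (additive primes divide the conductor twice) -/

-- adapted from Summits/ABC/ABC/Theorems/DefiniteXiFreyModularityStubNineTransfer.lean
-- (`sq_dvd_conductorNorm_iff_hasAdditiveReductionAt`), copied to keep the O5 import graph in BSD.
omit [G.IsGloballyMinimal] in
/-- `p² ∣ N_E` iff additive reduction at the place `v` of `𝓞 ℚ` over `p` (`v_p(N_E) = f_v`,
`factorization_conductorNorm_holds` read over `𝓞 ℚ` by `conductorExponent_ringOfIntegers_eq`;
`f_v ≥ 2 ↔` additive, `two_le_conductorExponent_iff_holds`, Silverman ATAEC IV.10.2(c)).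
[cite: SilvermanATAEC1994, Thm. IV.10.2(c)] -/
private theorem sq_dvd_conductorNorm_iff_hasAdditiveReductionAt' {p : ℕ} (hp : p.Prime)
    {v : HeightOneSpectrum (𝓞 ℚ)} (hv : (Rat.HeightOneSpectrum.primesEquiv v : ℕ) = p) :
    p ^ 2 ∣ G.conductorNorm ℤ ↔ G.HasAdditiveReductionAt v := by
  set pp : Nat.Primes := ⟨p, hp⟩ with hpp
  have hvp : Rat.HeightOneSpectrum.primesEquiv v = pp := Subtype.ext hv
  set vZ : HeightOneSpectrum ℤ := (Rat.HeightOneSpectrum.primesEquiv (R := ℤ)).symm pp with hvZ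
  have hfac := factorization_conductorNorm_holds G vZ
  have hgen : Rat.HeightOneSpectrum.natGenerator vZ = p := by
    change ((Rat.HeightOneSpectrum.primesEquiv vZ : Nat.Primes) : ℕ) = p
    rw [hvZ, Equiv.apply_symm_apply]
  rw [hgen] at hfac
  have hf : G.conductorExponent v = G.conductorExponent vZ := by
    rw [conductorExponent_ringOfIntegers_eq G v, hvp]
  rw [Nat.Prime.pow_dvd_iff_le_factorization hp (conductorNorm_pos_holds G).ne', hfac, ← hf,
    two_le_conductorExponent_iff_holds v G]

/-- **`3 ∣ Δ_min(G)` and `3 ∣ c₄(integralModelInt G)` ⟹ `9 ∣ N_G`**: additive reduction at `3`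
(Silverman *AEC* VII.5.1(c), `hasAdditiveReductionAt_of_dvd_of_dvd`) and `f₃ ≥ 2` (ATAEC IV.10.2(c)).
[cite: SilvermanAEC2009, VII.5 Prop. 5.1(c)] -/
theorem nine_dvd_conductorNorm_of_three_dvd_of_three_dvd (hΔ : (3 : ℤ) ∣ G.minimalDiscriminantInt)
    (hc₄ : (3 : ℤ) ∣ (integralModelInt G).c₄) : 9 ∣ G.conductorNorm ℤ := by
  set v : HeightOneSpectrum (𝓞 ℚ) := Rat.HeightOneSpectrum.primesEquiv.symm ⟨3, Nat.prime_three⟩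
    with hv
  have hv3 : (Rat.HeightOneSpectrum.primesEquiv v : ℕ) = 3 := by
    rw [hv, Equiv.apply_symm_apply]
  have hadd : G.HasAdditiveReductionAt v :=
    G.hasAdditiveReductionAt_of_dvd_of_dvd v (by rw [hv3]; exact hΔ) (by rw [hv3]; exact hc₄)
  have h9 : 3 ^ 2 ∣ G.conductorNorm ℤ :=
    (sq_dvd_conductorNorm_iff_hasAdditiveReductionAt' G Nat.prime_three hv3).mpr hadd
  simpa using h9

/-! ## §4 The local half: semistable at `3` ⟹ (`3 ∣ a₃(G) ↔ G[3]|G_{ℚ₃}` irreducible) -/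

/-- **G3-2, LOCAL HALF (theorem).** For every globally minimal elliptic `G / ℚ` SEMISTABLE at `3`
(`9 ∤ N_G`): `3 ∣ a₃(G) ↔ LocIrr G 3`, with `a₃(G) = G.LFunction 3` the `3`-rd coefficient of
Mathlib's `L(G, s)`. Good `3`: `a₃ = 3 + 1 − #G̃(𝔽₃)` and supersingular ⟺ locally irreducible
(Serre 1972 §1.11 Prop. 12; `Additive.locIrr_three_iff_dvd_frobeniusTrace_of_hasGoodReductionAtPrime`);
multiplicative `3`: `a₃ = ±1` (Silverman §C.16; `lFunction_prime_eq_one_or_eq_neg_one_of_dvd_of_not_dvd`)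
and the Tate-curve line makes `G[3]|G_{ℚ₃}` reducible (here: `3 ∤ c₄`, §2); additive `3` is excluded
by `9 ∤ N_G` (§3). [cite: Serre1972, §1.11 Prop. 11–12] -/
theorem dvd_lFunction_three_iff_locIrr_three_of_not_nine_dvd_conductorNorm
    (h9 : ¬ 9 ∣ G.conductorNorm ℤ) : (3 : ℤ) ∣ G.LFunction 3 ↔ LocIrr G 3 := by
  by_cases hΔ : (3 : ℤ) ∣ G.minimalDiscriminantInt
  · -- bad reduction at `3`; additive is excluded, so multiplicative: `3 ∤ c₄`
    have hc₄ : ¬ (3 : ℤ) ∣ (integralModelInt G).c₄ := fun hc₄ ↦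
      h9 (nine_dvd_conductorNorm_of_three_dvd_of_three_dvd G hΔ hc₄)
    have hL : ¬ (3 : ℤ) ∣ G.LFunction 3 := by
      rcases G.lFunction_prime_eq_one_or_eq_neg_one_of_dvd_of_not_dvd 3 hΔ hc₄ with h | h <;>
        rw [h] <;> omega
    exact iff_of_false hL (not_locIrr_three_of_not_three_dvd_c₄ G hc₄)
  · -- good reduction at `3`
    have hgood : G.HasGoodReductionAtPrime 3 := G.hasGoodReductionAtPrime_of_not_dvd 3 hΔ
    rw [G.LFunction_apply_prime_eq_frobeniusTrace 3 hgood]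
    exact (locIrr_three_iff_dvd_frobeniusTrace_of_hasGoodReductionAtPrime G hgood).symm

/-- One-sided form: at a prime `3` of semistable reduction, `3 ∣ a₃(G)` (necessarily good
supersingular) forces `G[3]|G_{ℚ₃}` irreducible. [cite: Serre1972, §1.11 Prop. 12] -/
theorem locIrr_three_of_dvd_lFunction_three_of_not_nine_dvd_conductorNorm
    (h9 : ¬ 9 ∣ G.conductorNorm ℤ) (h3 : (3 : ℤ) ∣ G.LFunction 3) : LocIrr G 3 :=
  (dvd_lFunction_three_iff_locIrr_three_of_not_nine_dvd_conductorNorm G h9).mp h3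

/-- One-sided form: at a prime `3` of semistable reduction, `3 ∤ a₃(G)` (good ordinary or
multiplicative) forces `G[3]|G_{ℚ₃}` reducible. [cite: Serre1972, §1.11 Prop. 11] -/
theorem not_locIrr_three_of_not_dvd_lFunction_three_of_not_nine_dvd_conductorNorm
    (h9 : ¬ 9 ∣ G.conductorNorm ℤ) (h3 : ¬ (3 : ℤ) ∣ G.LFunction 3) : ¬ LocIrr G 3 :=
  fun hL ↦ h3 ((dvd_lFunction_three_iff_locIrr_three_of_not_nine_dvd_conductorNorm G h9).mpr hL)

end MinimalModel

/-! ## §5 The node from the Brauer–Nesbitt–Chebotarev transport -/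

/-- **Per-pair form (theorem).** For elliptic `W, G / ℚ` with a `Gal(ℚ̄/ℚ)`-equivariant
`e : G[3] ≃ W[3]` (from whatever source: a certified congruence, an isogeny, the O6 companion
predicate `Additive.IsCompanionThree`) and `G` globally minimal, semistable at `3` (`9 ∤ N_G`):
`3 ∣ a₃(G) ↔ LocIrr W 3`. (`Additive.locIrr_iff_of_equivariant` + §4.) [cite: Serre1972, §1.11 Prop. 11–12] -/
theorem dvd_lFunction_three_iff_locIrr_three_of_equivariant (W G : WeierstrassCurve ℚ)
    [W.IsElliptic] [G.IsElliptic] [G.IsGloballyMinimal]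
    (e : geomTorsion G (3 : ℤ) ≃+ geomTorsion W (3 : ℤ))
    (he : ∀ (σ : Field.absoluteGaloisGroup ℚ) (P : geomTorsion G (3 : ℤ)), e (σ • P) = σ • e P)
    (h9 : ¬ 9 ∣ G.conductorNorm ℤ) : (3 : ℤ) ∣ G.LFunction 3 ↔ LocIrr W 3 := by
  rw [locIrr_iff_of_equivariant W G 3 e he]
  exact dvd_lFunction_three_iff_locIrr_three_of_not_nine_dvd_conductorNorm G h9

/-- **G3-2 `CompanionTypeLawThree` from ONE labelled binder.** `hBNC` (Brauer–Nesbitt–Chebotarev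
transport; Darmon–Diamond–Taylor 1995 Prop. 2.6(b) with 2.8(a), 2.11(a); cite-only, NOT a Literature
fact, NOT discharged here): a companion `G` of `W` at `3` in the node's sense (`9 ∤ N_G` and
`a_ℓ(W) ≡ a_ℓ(G) (mod 3)` for all primes `ℓ ∤ 3·N_W·N_G`) with `ρ̄_{W,3}` irreducible has
`G[3] ≅ W[3]` `Gal(ℚ̄/ℚ)`-equivariantly. Given `hBNC`, the node is the composition of
`Additive.locIrr_iff_of_equivariant` (`LocIrr W 3 ↔ LocIrr G 3`) with the local half (§4) at the
semistable prime `3` of `G`. The binders `ClassO5 W 3`, `SubTprime W 3` of the node are not used.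
[cite: DarmonDiamondTaylor1995, Prop. 2.6(b), Prop. 2.8(a), Prop. 2.11(a) (PDF pp. 53–57)]
[cite: Serre1972, §1.11 Prop. 11–12] -/
theorem companionTypeLawThree_of_modThreeTransport
    (hBNC : ∀ (W G : WeierstrassCurve ℚ) [W.IsElliptic] [W.IsGloballyMinimal] [G.IsElliptic]
      [G.IsGloballyMinimal], W.HasIrreducibleModPGaloisRep 3 → IsCompanionAtThree W G →
        ∃ e : geomTorsion G (3 : ℤ) ≃+ geomTorsion W (3 : ℤ),
          ∀ (σ : Field.absoluteGaloisGroup ℚ) (P : geomTorsion G (3 : ℤ)), e (σ • P) = σ • e P) :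
    CompanionTypeLawThree := by
  intro W G _ _ _ _ _hO5 _hT hirr hcomp
  obtain ⟨e, he⟩ := hBNC W G hirr hcomp
  exact dvd_lFunction_three_iff_locIrr_three_of_equivariant W G e he hcomp.1

end Summit.BirchSwinnertonDyer.Rank1Residual.O5
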